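import Literature.NumberTheory.Sieve.MatomakiRadziwillProp1E1
import HarnessLib

/-!
# Matomäki–Radziwiłł 2016, Proposition 1 for general coefficients — (a) the reduction (23) and (b) `E₁`

Topic `NumberTheory/Sieve`.  Everything in this file is PROVED; no definitions, no named facts.

The assembly of Proposition 1 of K. Matomäki, M. Radziwiłł, *Multiplicative functions in short intervals*,
Ann. of Math. 183 (2016), §8, in the tree (`MatomakiRadziwillProp1Partition`, `…E1`, `…Ej`, `…U1`–`U3`,
`…Prop1`) is written for a REAL multiplicative `f` (`f : ArithmeticFunction ℝ`, coefficients `I.aCoef f`,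
`I.bCoef f j`, `c_p = f(p)`) and for the interval system attached to the summation range (`I : SieveIntervalSystem η X`
with the sum over `X ≤ n ≤ 2X`).  Appendix A of Matomäki–Radziwiłł–Tao 2015 (Proposition A.3) needs the same
argument for COMPLEX `f` and for an interval system `I : SieveIntervalSystem η X₀` with `√X ≤ X₀ ≤ X` ("In the
region `|t - t₁| ≥ (log X)^{1/16}` … in exactly the same way as [MR]").  This file starts the general-coefficient
form of the assembly, in which the three coefficient sequences `a` (for `F`), `b_j` (for `R_{v,H_j}`) and `c` (for
`Q_{v,H_j}`) are arbitrary `1`-bounded complex sequences tied by the factorisation hypothesis of Lemma 12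
(`a_{mp} = b_j(m) c_p` for `p ∈ [P_j, Q_j]` prime, `p ∤ m`) and the support condition `a_n ≠ 0 → n ∈ 𝒮`; the
range `X` is decoupled from the system's `X₀ ≤ X`.  The proofs are those of the tree files, verbatim up to these
substitutions:

* `coprime_sum_eq_zero_of_supp` — the coprime term of Lemma 12 vanishes when `a` is supported on `𝒮`;
* `integral_Tset_le_coef`, `integral_le_sum_Tset_add_Uset_coef` — Lemma 12 on `𝒯_j` and the reduction (23)
  (`MatomakiRadziwillProp1Partition.integral_Tset_le`, `integral_le_sum_Tset_add_Uset`);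
* `E_one_le_coef` — §8.1, the bound for `E₁` (`MatomakiRadziwillProp1E1.E_one_le`), for any `c`, `|b| ≤ 1`,
  `e ≤ X₀ ≤ X`.

For completely multiplicative complex `f` one takes `a = f 1_𝒮`, `b_j = f 1_{𝒮_j}`, `c = f` (the factorisation
is `SieveIntervalSystem.mem_mul_prime_iff`).

## References
* K. Matomäki, M. Radziwiłł, Ann. of Math. (2) 183 (2016), 1015–1056 (arXiv:1501.04585), §8 up to (23) and §8.1.
  [cite: MatomakiRadziwillAnnals2016, §8 (23), §8.1]
* K. Matomäki, M. Radziwiłł, T. Tao, Algebra & Number Theory 9 (2015), Appendix A, Proposition A.3 (proof).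
  [cite: MatomakiRadziwillTao2015, Appendix A, Proposition A.3 (proof)]
-/

noncomputable section

open Finset Complex MeasureTheory

namespace Literature.NumberTheory.Sieve

namespace SieveIntervalSystem

variable {η X₀ : ℝ} (I : SieveIntervalSystem η X₀)

/-! ### The reduction (23) for general coefficients -/

/-- If `a` is supported on `𝒮` then for `1 ≤ j ≤ J` the "coprime" term of Lemma 12 vanishes: every `n ∈ 𝒮` has a
prime factor in `[P_j, Q_j]`. [cite: MatomakiRadziwillAnnals2016, §8] -/
theorem coprime_sum_eq_zero_of_supp (a : ℕ → ℂ) (hsupp : ∀ n, a n ≠ 0 → I.Mem n) (X : ℝ) {j : ℕ}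
    (hj : j ∈ Icc 1 I.J) :
    ∑ n ∈ (Icc ⌈X⌉₊ ⌊2 * X⌋₊).filter
        (fun n : ℕ => ∀ p ∈ (Icc ⌈I.P j⌉₊ ⌊I.Q j⌋₊).filter Nat.Prime, ¬ p ∣ n),
      ‖a n‖ ^ 2 / n = 0 := by
  refine sum_eq_zero fun n hn => ?_
  rw [mem_filter] at hn
  have : a n = 0 := by
    by_contra hne
    obtain ⟨p, hp, hPp, hpQ⟩ := hsupp n hne j hj
    have hpP : p ∈ (Icc ⌈I.P j⌉₊ ⌊I.Q j⌋₊).filter Nat.Prime := by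
      rw [mem_filter, mem_Icc]
      exact ⟨⟨Nat.ceil_le.2 hPp, Nat.le_floor hpQ⟩, Nat.prime_of_mem_primeFactors hp⟩
    exact hn.2 p hpP (Nat.dvd_of_mem_primeFactors hp)
  rw [this, norm_zero]
  simp

/-- **Lemma 12 on `𝒯_j`, general coefficients** (§8, the display after "we see that"): for `1 ≤ j ≤ J` with
`H_j ≥ 1`, `X, T ≥ 1`, `0 ≤ T₀`, `1`-bounded `a, b, c` with `a_{mp} = b_m c_p` (`p ∈ [P_j, Q_j]` prime, `p ∤ m`)
and `a` supported on `𝒮`,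
`∫_{𝒯_j} |∑ a_n n^{-1-it}|² dt ≤ C₁₂ (H_j log(Q_j/P_j) ∑_{v ∈ ℐ_j} ∫_{𝒯_j} |Q_{v,H_j} R_{v,H_j}|² dt + (T+X)/X (1/H_j + 1/P_j))`,
`C₁₂ = 20000`, `Q_{v,H_j} = blockPrimePoly c …`, `R_{v,H_j} = blockCofactorPoly b …`.
[cite: MatomakiRadziwillAnnals2016, §8] -/
theorem integral_Tset_le_coef (hη : 0 < η) (hη' : η ≤ 8) (a b c : ℕ → ℂ) (ha : ∀ n, ‖a n‖ ≤ 1)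
    (hb : ∀ m, ‖b m‖ ≤ 1) (hc : ∀ p, ‖c p‖ ≤ 1) (hsupp : ∀ n, a n ≠ 0 → I.Mem n) {X : ℝ} (hX : 1 ≤ X)
    {T₀ T : ℝ} (hT₀ : 0 ≤ T₀) (hT : 1 ≤ T) {j : ℕ} (hj : j ∈ Icc 1 I.J) (hH : 1 ≤ I.Hpar j)
    (hfac : ∀ m p : ℕ, p.Prime → I.P j ≤ p → (p : ℝ) ≤ I.Q j → ¬ p ∣ m → a (m * p) = b m * c p) :
    ∫ t in I.Tset c T₀ T j,
        ‖∑ n ∈ Icc ⌈X⌉₊ ⌊2 * X⌋₊, a n * (n : ℂ) ^ (-(1 + (t : ℂ) * Complex.I))‖ ^ 2 ≤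
      20000 * ((I.Hpar j * Real.log (I.Q j / I.P j)) *
          (∑ v ∈ I.blocks j, ∫ t in I.Tset c T₀ T j,
            ‖blockPrimePoly c (I.P j) (I.Q j) (I.Hpar j) v t *
              blockCofactorPoly b X (I.P j) (I.Q j) (I.Hpar j) v t‖ ^ 2)
        + (T + X) / X * (1 / I.Hpar j + 1 / I.P j)) := by
  have hj1 : 1 ≤ j := (mem_Icc.1 hj).1
  have hsub : I.Tset c T₀ T j ⊆ Set.Icc (-T) T :=
    (I.Tset_subset _ T₀ T j).trans (Set.Icc_subset_Icc (by linarith) le_rfl)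
  have h := MatomakiRadziwillLemma12.lemma12_bound X T (I.P j) (I.Q j) (I.Hpar j) a b c (I.Tset c T₀ T j) hX hT
    (I.one_le_P hη hη' hj1) (I.P_le_Q j hj1) hH ha hb hc hfac hsub
  rw [I.coprime_sum_eq_zero_of_supp a hsupp X hj, add_zero] at h
  unfold blocks
  exact h

/-- **The reduction (23) of §8, general coefficients**: for `X, T ≥ 1`, `0 ≤ T₀ ≤ T`, `H_j ≥ 1` (`1 ≤ j ≤ J`),
`1`-bounded `a, c` and `b_j` (`j ≤ J`) with `a_{mp} = b_j(m) c_p` and `a` supported on `𝒮`,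
`∫_{T₀}^{T} |∑ a_n n^{-1-it}|² dt ≤ ∑_{j=1}^{J} C₁₂ (H_j log(Q_j/P_j) ∑_{v∈ℐ_j} ∫_{𝒯_j} |Q_{v,H_j} R_{v,H_j}|² dt
 + (T+X)/X (1/H_j + 1/P_j)) + ∫_𝒰 |∑ a_n n^{-1-it}|² dt`. [cite: MatomakiRadziwillAnnals2016, §8 (23)] -/
theorem integral_le_sum_Tset_add_Uset_coef (hη : 0 < η) (hη' : η ≤ 8) (a c : ℕ → ℂ) (b : ℕ → ℕ → ℂ)
    (ha : ∀ n, ‖a n‖ ≤ 1) (hb : ∀ j m, ‖b j m‖ ≤ 1) (hc : ∀ p, ‖c p‖ ≤ 1) (hsupp : ∀ n, a n ≠ 0 → I.Mem n)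
    {X : ℝ} (hX : 1 ≤ X) {T₀ T : ℝ} (hT₀ : 0 ≤ T₀) (hT₀T : T₀ ≤ T) (hT : 1 ≤ T)
    (hH : ∀ j ∈ Icc 1 I.J, 1 ≤ I.Hpar j)
    (hfac : ∀ j ∈ Icc 1 I.J, ∀ m p : ℕ, p.Prime → I.P j ≤ p → (p : ℝ) ≤ I.Q j → ¬ p ∣ m →
      a (m * p) = b j m * c p) :
    ∫ t in T₀..T, ‖∑ n ∈ Icc ⌈X⌉₊ ⌊2 * X⌋₊, a n * (n : ℂ) ^ (-(1 + (t : ℂ) * Complex.I))‖ ^ 2 ≤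
      (∑ j ∈ Icc 1 I.J, 20000 * ((I.Hpar j * Real.log (I.Q j / I.P j)) *
          (∑ v ∈ I.blocks j, ∫ t in I.Tset c T₀ T j,
            ‖blockPrimePoly c (I.P j) (I.Q j) (I.Hpar j) v t *
              blockCofactorPoly (b j) X (I.P j) (I.Q j) (I.Hpar j) v t‖ ^ 2)
        + (T + X) / X * (1 / I.Hpar j + 1 / I.P j)))
      + ∫ t in I.Uset c T₀ T,
          ‖∑ n ∈ Icc ⌈X⌉₊ ⌊2 * X⌋₊, a n * (n : ℂ) ^ (-(1 + (t : ℂ) * Complex.I))‖ ^ 2 := by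
  have hcont : Continuous fun t : ℝ =>
      ‖∑ n ∈ Icc ⌈X⌉₊ ⌊2 * X⌋₊, a n * (n : ℂ) ^ (-(1 + (t : ℂ) * Complex.I))‖ ^ 2 :=
    ((MatomakiRadziwillLemma12.continuous_dsum _ _).norm).pow 2
  rw [intervalIntegral.integral_of_le hT₀T, ← integral_Icc_eq_integral_Ioc,
    I.integral_Icc_eq_sum_add c T₀ T hcont.integrableOn_Icc]
  gcongr with j hj
  exact I.integral_Tset_le_coef hη hη' a (b j) c ha (hb j) hc hsupp hX hT₀ hT hj (hH j hj) (hfac j hj)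

/-! ### §8.1 for general coefficients -/

/-- **§8.1, the bound for `E_1`**: with `C₁₂ = 20000`, `α₁ = 1/4 - 3η/2 > 0` (`0 < η < 1/6`),
`log X ≥ 1`, `T ≥ 1`, `T₀ ≥ 0` and `H₁ ≥ 1`,
`C₁₂ · H₁ log(Q₁/P₁) · ∑_{v ∈ ℐ₁} ∫_{𝒯₁} |Q_{v,H₁} R_{v,H₁}|² dt ≤ 5760000 (1 + 1/(2α₁)) (T Q₁/X + 1) / H₁`,
where `1/H₁ = (log Q₁)^{1/3}/P₁^{1/6-η}`.  Proof as printed: on `𝒯₁`, `|Q_{v,H₁}| ≤ e^{-α₁ v/H₁}`; the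
mean value theorem for `R_{v,H₁}` (`integral_blockCofactorPoly_le`); the geometric series
`∑_{v ≥ H₁ log P₁ - 1} e^{-2α₁v/H₁} ≤ e^{1/2} P₁^{-2α₁} (1 + H₁/(2α₁))`; and `H₁² log Q₁ P₁^{-2α₁} = 1/H₁`
(`Hpar_one_cube_mul`). [cite: MatomakiRadziwillAnnals2016, §8.1] -/
theorem E_one_le_coef (hη : 0 < η) (hη6 : η < 1 / 6) (c b : ℕ → ℂ) (hb : ∀ m, ‖b m‖ ≤ 1)
    {X : ℝ} (hX₀e : Real.exp 1 ≤ X₀) (hX₀X : X₀ ≤ X) {T₀ T : ℝ} (hT₀ : 0 ≤ T₀) (hT : 1 ≤ T)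
    (hH1 : 1 ≤ I.Hpar 1) :
    20000 * ((I.Hpar 1 * Real.log (I.Q 1 / I.P 1)) *
        (∑ v ∈ I.blocks 1, ∫ t in I.Tset c T₀ T 1,
          ‖blockPrimePoly c (I.P 1) (I.Q 1) (I.Hpar 1) v t *
            blockCofactorPoly b X (I.P 1) (I.Q 1) (I.Hpar 1) v t‖ ^ 2)) ≤
      2880000 * (1 + 1 / (2 * alpha η 1)) * (T * I.Q 1 / X + 1) * (1 / I.Hpar 1) := by
  have hη' : η ≤ 8 := by linarith
  have hα : 0 < alpha η 1 := by rw [alpha_one]; linarith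
  have hα4 : alpha η 1 < 1 / 4 := by rw [alpha_one]; linarith
  have hP : 0 < I.P 1 := I.pos_P 1 le_rfl
  have hP1 : 1 ≤ I.P 1 := I.one_le_P_one
  have hQ1 : 1 ≤ I.Q 1 := I.one_le_Q hη hη' le_rfl
  have hQ0 : 0 < I.Q 1 := by linarith
  have hL : 1 < Real.log (I.Q 1) := I.one_lt_log_Q_one hη hη'
  have hlogP : 0 ≤ Real.log (I.P 1) := Real.log_nonneg hP1
  have hX0 : 0 < X := lt_of_lt_of_le (Real.exp_pos 1) (hX₀e.trans hX₀X)
  have hQX : I.Q 1 ≤ X := (I.Q_one_le_X hη hη' hX₀e).trans hX₀X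
  have hH0 : 0 < I.Hpar 1 := by linarith
  have hT0 : 0 < T := by linarith
  have hR0 : 0 ≤ T * I.Q 1 / X + 1 := by positivity
  have hsubT : I.Tset c T₀ T 1 ⊆ Set.Icc (-T) T :=
    (I.Tset_subset _ T₀ T 1).trans (Set.Icc_subset_Icc (by linarith) le_rfl)
  -- the ratio of the geometric series
  have hκ0 : 0 < 2 * alpha η 1 / I.Hpar 1 := by positivity
  have hκ : 2 * alpha η 1 / I.Hpar 1 ≤ 1 / 2 := by
    rw [div_le_iff₀ hH0]; nlinarith
  have hr0 : 0 ≤ Real.exp (-(2 * alpha η 1 / I.Hpar 1)) := (Real.exp_pos _).le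
  have hr1 : Real.exp (-(2 * alpha η 1 / I.Hpar 1)) < 1 := Real.exp_lt_one_iff.2 (by linarith)
  -- per-block bound
  have hblock : ∀ v ∈ I.blocks 1,
      ∫ t in I.Tset c T₀ T 1,
          ‖blockPrimePoly c (I.P 1) (I.Q 1) (I.Hpar 1) v t *
            blockCofactorPoly b X (I.P 1) (I.Q 1) (I.Hpar 1) v t‖ ^ 2 ≤
        Real.exp (-(2 * alpha η 1 / I.Hpar 1)) ^ v * (72 * (T * I.Q 1 / X + 1)) := by
    intro v hv
    have hexpQ : Real.exp ((v : ℝ) / I.Hpar 1) ≤ I.Q 1 := I.exp_div_Hpar_le hη hη' le_rfl hv hH0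
    have hE : 1 ≤ X * Real.exp (-((v : ℝ) / I.Hpar 1)) := by
      rw [Real.exp_neg, ← div_eq_mul_inv, le_div_iff₀ (Real.exp_pos _), one_mul]
      exact hexpQ.trans hQX
    -- pointwise bound on `𝒯₁`
    have hpt : ∀ t ∈ I.Tset c T₀ T 1,
        ‖blockPrimePoly c (I.P 1) (I.Q 1) (I.Hpar 1) v t *
            blockCofactorPoly b X (I.P 1) (I.Q 1) (I.Hpar 1) v t‖ ^ 2 ≤
          Real.exp (-(2 * alpha η 1 / I.Hpar 1)) ^ v *
            ‖blockCofactorPoly b X (I.P 1) (I.Q 1) (I.Hpar 1) v t‖ ^ 2 := by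
      intro t ht
      have hgood : t ∈ I.goodSet c 1 := ht.1.2
      have hQv : ‖blockPrimePoly c (I.P 1) (I.Q 1) (I.Hpar 1) v t‖ ≤
          Real.exp (-(alpha η 1 * v / I.Hpar 1)) := by
        unfold goodSet at hgood
        have := Set.mem_iInter₂.1 hgood v hv
        exact this
      rw [norm_mul, mul_pow]
      have hexp_eq : Real.exp (-(2 * alpha η 1 / I.Hpar 1)) ^ v =
          Real.exp (-(alpha η 1 * v / I.Hpar 1)) ^ 2 := by
        rw [← Real.exp_nat_mul, ← Real.exp_nat_mul]
        congr 1
        push_cast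
        ring
      rw [hexp_eq]
      exact mul_le_mul_of_nonneg_right (pow_le_pow_left₀ (norm_nonneg _) hQv 2) (sq_nonneg _)
    -- integrate the pointwise bound
    have hcQ : Continuous fun t : ℝ =>
        blockPrimePoly c (I.P 1) (I.Q 1) (I.Hpar 1) v t := by
      unfold blockPrimePoly; exact MatomakiRadziwillLemma12.continuous_dsum _ _
    have hcR : Continuous fun t : ℝ =>
        blockCofactorPoly b X (I.P 1) (I.Q 1) (I.Hpar 1) v t := by
      unfold blockCofactorPoly
      exact continuous_finsetSum _ fun m _ =>
        (continuous_const.mul (MatomakiRadziwillLemma12.continuous_cpw m)).div_const _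
    have hiQR : IntegrableOn (fun t : ℝ =>
        ‖blockPrimePoly c (I.P 1) (I.Q 1) (I.Hpar 1) v t *
          blockCofactorPoly b X (I.P 1) (I.Q 1) (I.Hpar 1) v t‖ ^ 2)
        (I.Tset c T₀ T 1) :=
      MatomakiRadziwillLemma12.integrableOn_of_continuous ((hcQ.mul hcR).norm.pow 2) hsubT
    have hiR : IntegrableOn (fun t : ℝ => Real.exp (-(2 * alpha η 1 / I.Hpar 1)) ^ v *
        ‖blockCofactorPoly b X (I.P 1) (I.Q 1) (I.Hpar 1) v t‖ ^ 2)
        (I.Tset c T₀ T 1) :=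
      MatomakiRadziwillLemma12.integrableOn_of_continuous
        (continuous_const.mul (hcR.norm.pow 2)) hsubT
    calc ∫ t in I.Tset c T₀ T 1,
          ‖blockPrimePoly c (I.P 1) (I.Q 1) (I.Hpar 1) v t *
            blockCofactorPoly b X (I.P 1) (I.Q 1) (I.Hpar 1) v t‖ ^ 2
        ≤ ∫ t in I.Tset c T₀ T 1,
            Real.exp (-(2 * alpha η 1 / I.Hpar 1)) ^ v *
              ‖blockCofactorPoly b X (I.P 1) (I.Q 1) (I.Hpar 1) v t‖ ^ 2 :=
          setIntegral_mono_on hiQR hiR (I.measurableSet_Tset _ T₀ T 1) hpt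
      _ = Real.exp (-(2 * alpha η 1 / I.Hpar 1)) ^ v *
            ∫ t in I.Tset c T₀ T 1,
              ‖blockCofactorPoly b X (I.P 1) (I.Q 1) (I.Hpar 1) v t‖ ^ 2 :=
          integral_const_mul _ _
      _ ≤ Real.exp (-(2 * alpha η 1 / I.Hpar 1)) ^ v *
            (10 * T * Real.exp ((v : ℝ) / I.Hpar 1) / X + 72) :=
          mul_le_mul_of_nonneg_left (integral_blockCofactorPoly_le hb
            (I.P 1) (I.Q 1) hT0 hsubT hX0 v hE) (pow_nonneg hr0 v)
      _ ≤ Real.exp (-(2 * alpha η 1 / I.Hpar 1)) ^ v * (72 * (T * I.Q 1 / X + 1)) := by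
          refine mul_le_mul_of_nonneg_left ?_ (pow_nonneg hr0 v)
          have h0 : T * Real.exp ((v : ℝ) / I.Hpar 1) / X ≤ T * I.Q 1 / X :=
            div_le_div_of_nonneg_right (mul_le_mul_of_nonneg_left hexpQ hT0.le) hX0.le
          have e1 : 10 * T * Real.exp ((v : ℝ) / I.Hpar 1) / X =
              10 * (T * Real.exp ((v : ℝ) / I.Hpar 1) / X) := by ring
          have h72 : 0 ≤ T * I.Q 1 / X := by positivity
          linarith [h0, e1, h72]
  -- sum over the blocks and the geometric series
  have hsum : ∑ v ∈ I.blocks 1, ∫ t in I.Tset c T₀ T 1,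
        ‖blockPrimePoly c (I.P 1) (I.Q 1) (I.Hpar 1) v t *
          blockCofactorPoly b X (I.P 1) (I.Q 1) (I.Hpar 1) v t‖ ^ 2 ≤
      (∑ v ∈ I.blocks 1, Real.exp (-(2 * alpha η 1 / I.Hpar 1)) ^ v) * (72 * (T * I.Q 1 / X + 1)) := by
    rw [sum_mul]
    exact sum_le_sum hblock
  have hgeom : ∑ v ∈ I.blocks 1, Real.exp (-(2 * alpha η 1 / I.Hpar 1)) ^ v ≤
      2 * I.P 1 ^ (-(1 / 2 : ℝ) + 3 * η) * (1 + I.Hpar 1 / (2 * alpha η 1)) := by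
    unfold blocks
    refine (sum_Icc_pow_le hr0 hr1 _ _).trans ?_
    rw [div_eq_mul_one_div]
    refine mul_le_mul ?_ ?_ (by positivity) (by positivity)
    · -- `r^{v₀} ≤ e^{1/2} P₁^{-2α₁} ≤ 2 P₁^{-2α₁}`
      have hv₀ : I.Hpar 1 * Real.log (I.P 1) - 1 < ⌊I.Hpar 1 * Real.log (I.P 1)⌋₊ := by
        linarith [Nat.lt_floor_add_one (I.Hpar 1 * Real.log (I.P 1))]
      rw [← Real.exp_nat_mul]
      have he : Real.exp (1 / 2) ≤ 2 := by
        have h1 : Real.exp (1 / 2) * Real.exp (1 / 2) = Real.exp 1 := by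
          rw [← Real.exp_add]; norm_num
        have h2 := Real.exp_one_lt_d9
        nlinarith [Real.exp_pos (1 / 2)]
      calc Real.exp ((⌊I.Hpar 1 * Real.log (I.P 1)⌋₊ : ℕ) * -(2 * alpha η 1 / I.Hpar 1))
          ≤ Real.exp (1 / 2 + Real.log (I.P 1) * (-(1 / 2) + 3 * η)) := by
            apply Real.exp_le_exp.2
            have hmul := mul_lt_mul_of_pos_left hv₀ hκ0
            have hid : 2 * alpha η 1 / I.Hpar 1 * (I.Hpar 1 * Real.log (I.P 1) - 1) =
                2 * alpha η 1 * Real.log (I.P 1) - 2 * alpha η 1 / I.Hpar 1 := by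
              field_simp
            have hα1 : 2 * alpha η 1 = 1 / 2 - 3 * η := by rw [alpha_one]; ring
            rw [hid] at hmul
            nlinarith
        _ = Real.exp (1 / 2) * I.P 1 ^ (-(1 / 2 : ℝ) + 3 * η) := by
            rw [Real.exp_add, Real.rpow_def_of_pos hP]
        _ ≤ 2 * I.P 1 ^ (-(1 / 2 : ℝ) + 3 * η) :=
            mul_le_mul_of_nonneg_right he (by positivity)
    · -- `1/(1-r) ≤ 1 + H₁/(2α₁)`
      have := one_div_one_sub_exp_neg_le hκ0
      rwa [one_div_div] at this
  -- `log(Q₁/P₁) ≤ log Q₁`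
  have hlogQP : Real.log (I.Q 1 / I.P 1) ≤ Real.log (I.Q 1) := by
    rw [Real.log_div hQ0.ne' hP.ne']
    linarith
  have hS0 : 0 ≤ ∑ v ∈ I.blocks 1, ∫ t in I.Tset c T₀ T 1,
      ‖blockPrimePoly c (I.P 1) (I.Q 1) (I.Hpar 1) v t *
        blockCofactorPoly b X (I.P 1) (I.Q 1) (I.Hpar 1) v t‖ ^ 2 :=
    sum_nonneg fun v _ => integral_nonneg fun t => by positivity
  -- the key identity
  have hkey : I.Hpar 1 * Real.log (I.Q 1) * I.P 1 ^ (-(1 / 2 : ℝ) + 3 * η) *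
      (1 + I.Hpar 1 / (2 * alpha η 1)) ≤ (1 + 1 / (2 * alpha η 1)) * (1 / I.Hpar 1) := by
    have hE : 1 + I.Hpar 1 / (2 * alpha η 1) ≤ I.Hpar 1 * (1 + 1 / (2 * alpha η 1)) := by
      rw [mul_add, mul_one, mul_one_div]
      linarith
    have hcube := I.Hpar_one_cube_mul hη hη'
    calc I.Hpar 1 * Real.log (I.Q 1) * I.P 1 ^ (-(1 / 2 : ℝ) + 3 * η) * (1 + I.Hpar 1 / (2 * alpha η 1))
        ≤ I.Hpar 1 * Real.log (I.Q 1) * I.P 1 ^ (-(1 / 2 : ℝ) + 3 * η) *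
            (I.Hpar 1 * (1 + 1 / (2 * alpha η 1))) :=
          mul_le_mul_of_nonneg_left hE (by positivity)
      _ = (1 + 1 / (2 * alpha η 1)) *
            (I.Hpar 1 ^ 3 * Real.log (I.Q 1) * I.P 1 ^ (-(1 / 2 : ℝ) + 3 * η)) / I.Hpar 1 := by
          field_simp
      _ = (1 + 1 / (2 * alpha η 1)) * (1 / I.Hpar 1) := by rw [hcube]; ring
  -- assemble
  calc 20000 * ((I.Hpar 1 * Real.log (I.Q 1 / I.P 1)) *
        (∑ v ∈ I.blocks 1, ∫ t in I.Tset c T₀ T 1,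
          ‖blockPrimePoly c (I.P 1) (I.Q 1) (I.Hpar 1) v t *
            blockCofactorPoly b X (I.P 1) (I.Q 1) (I.Hpar 1) v t‖ ^ 2))
      ≤ 20000 * ((I.Hpar 1 * Real.log (I.Q 1)) *
          ((2 * I.P 1 ^ (-(1 / 2 : ℝ) + 3 * η) * (1 + I.Hpar 1 / (2 * alpha η 1))) *
            (72 * (T * I.Q 1 / X + 1)))) := by
        gcongr 20000 * (?_ * ?_)
        · exact mul_le_mul_of_nonneg_left hlogQP hH0.le
        · exact hsum.trans (mul_le_mul_of_nonneg_right hgeom (by positivity))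
    _ = 2880000 * (T * I.Q 1 / X + 1) *
          (I.Hpar 1 * Real.log (I.Q 1) * I.P 1 ^ (-(1 / 2 : ℝ) + 3 * η) *
            (1 + I.Hpar 1 / (2 * alpha η 1))) := by ring
    _ ≤ 2880000 * (T * I.Q 1 / X + 1) * ((1 + 1 / (2 * alpha η 1)) * (1 / I.Hpar 1)) :=
        mul_le_mul_of_nonneg_left hkey (by positivity)
    _ = 2880000 * (1 + 1 / (2 * alpha η 1)) * (T * I.Q 1 / X + 1) * (1 / I.Hpar 1) := by ring



end SieveIntervalSystem

end Literature.NumberTheory.Sieve
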